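import Mathlib
import HarnessLib
import Summits.KontsevichZagierPeriods.KontsevichZagierPeriods.Theses.SymplecticScissors
import Literature.NumberTheory.Transcendental.AnalyticSubgroupElliptic

/-!
# Crux `PlanarK0Injective` (stmt-KontsevichZagierPeriods-9847) — ideator 3 sketch (round 1)

First lemmas of the two idea cards filed by `planner-cruxidea-stmt-KontsevichZagierPeriods-9847-3-0`:

* card `mordell-weil-normal-form`: `PlanarLogSector` (rung 0, Baker), `CubicSegments` (rung 1,
  one Weierstrass cubic; Leibniz's segment problem for cubics inside the planar group);
* card `sheet-cauchy-riemann-transport`: `CauchyRiemannTransport` (the engine: the `n = 2`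
  Cauchy–Riemann instance of the support `EqualJacobianTransport`) and `QuinticCauchyRelation`
  (genus-2 calibration: the dividing-curve relation among the three positive real cells of a
  quintic with five real roots, checked numerically to 1e-11 in the folder).

Everything is a `def … : Prop` over existing declarations; the only theorems are sanity
implications from the crux (special cases) and the `Iff.rfl` unfolding of the crux.
-/

namespace Summit.KontsevichZagierPeriods.KontsevichZagierPeriods.Cruxes.PlanarK0Injective.Ideator3

open Literature.NumberTheory.Transcendental
open Summit.KontsevichZagierPeriods.KontsevichZagierPeriods.Theses.SymplecticScissors

noncomputable section

/-- The planar set-chain group `G` of the crux: generated by the domain-additivity (1a) and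
change-of-variables (2) instances all of whose generators are PLANAR integrand-1 representations. -/
def planarGroup : AddSubgroup KZ.FormalRep :=
  AddSubgroup.closure ((KZ.domainAddRel ∪ KZ.changeOfVariablesRel) ∩
    (AddSubgroup.closure {x : KZ.FormalRep | ∃ s : KZ.IntegralRep 2,
      (∀ p ∈ s.domain, s.integrand p = 1) ∧ x = KZ.of s} : Set KZ.FormalRep))

/-- The crux, unfolded through `planarGroup`. -/
theorem planarK0Injective_iff :
    PlanarK0Injective ↔ ∀ (r r' : KZ.IntegralRep 2), (∀ p ∈ r.domain, r.integrand p = 1) →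
      (∀ p ∈ r'.domain, r'.integrand p = 1) → r.value = r'.value →
      KZ.of r - KZ.of r' ∈ planarGroup :=
  Iff.rfl

/-! ## Card `mordell-weil-normal-form` -/

/-- **Rung 0 (Baker sector, first lemma of the line).** Two subgraphs of rational functions
with rational coefficients over rational intervals, of equal (finite) area, are planar-scissors
congruent: `[r] − [r'] ∈ G`. Areas here are `ℚ̄`-combinations of `1`, logarithms and arguments of
algebraic numbers; the proof plan is the planar normal form (partial fractions by StackingShear,
log cells `L(β)` and arctan cells normalised over a multiplicative basis by the moves
`(u,v) ↦ (u/α, αv)` and the Möbius shears `u ↦ (u + t)/(1 − tu)`) and `baker_holds` (PROVED in the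
tree) for the independence of the normal periods. -/
def PlanarLogSector : Prop :=
  ∀ (p q p' q' : Polynomial ℚ) (a b a' b' : ℚ) (r r' : KZ.IntegralRep 2),
    (∀ x : ℝ, (a : ℝ) < x → x < (b : ℝ) → 0 < (q.map (algebraMap ℚ ℝ)).eval x) →
    (∀ x : ℝ, (a' : ℝ) < x → x < (b' : ℝ) → 0 < (q'.map (algebraMap ℚ ℝ)).eval x) →
    r.domain = {z | (a : ℝ) < z 0 ∧ z 0 < (b : ℝ) ∧ 0 < z 1 ∧
      z 1 < (p.map (algebraMap ℚ ℝ)).eval (z 0) / (q.map (algebraMap ℚ ℝ)).eval (z 0)} →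
    r'.domain = {z | (a' : ℝ) < z 0 ∧ z 0 < (b' : ℝ) ∧ 0 < z 1 ∧
      z 1 < (p'.map (algebraMap ℚ ℝ)).eval (z 0) / (q'.map (algebraMap ℚ ℝ)).eval (z 0)} →
    (∀ z ∈ r.domain, r.integrand z = 1) → (∀ z ∈ r'.domain, r'.integrand z = 1) →
    r.value = r'.value →
    KZ.of r - KZ.of r' ∈ planarGroup

/-- The Baker sector is a special case of the crux (sanity: the first lemma is ON the line). -/
theorem planarLogSector_of_crux (h : PlanarK0Injective) : PlanarLogSector :=
  fun _ _ _ _ _ _ _ _ r r' _ _ _ _ hr hr' hv => h r r' hr hr' hv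

/-- **Rung 1 (one non-CM Weierstrass cubic; Leibniz's segment problem for cubics inside the planar
group).** For a lattice `L` with real algebraic invariants `g₂, g₃` and no complex multiplication, two
segments `{a < x < b, 0 < y < √(4x³ − g₂x − g₃)}`, `{a' < x < b', …}` of the SAME curve
`E_L : y² = 4x³ − g₂x − g₃` with equal area are planar-scissors congruent. Areas are incomplete elliptic
integrals of the second kind plus algebraic numbers (`y dx = (4x³ − g₂x − g₃) dx/y ≡ c₁ dx/y + c₂ x dx/y +
d(γxy + δy)` on `E_L`, only pole at `O`, residue `0`); the plan: translations `τ_P` (`P` in the group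
generated by the end points), `[-1]` and the real 2-torsion translations are `ℚ`-semialgebraic maps with
`τ_P^*(dx/y) = dx/y`, hence FiniteMapShear instances (`TranslationShear`); reduce to a `ℤ`-basis of the
end-point group (arcs on the circle `E_L(ℝ)⁰`, 1a) and conclude by `analyticSubgroupTheorem_GaGmE`
(PROVED in the tree from `philippon1986_std_holds`) at the single point
`u = (1; ; (ω₁, η₁), (z(Pᵢ), t(Pᵢ))ᵢ)`. No 2-chain. Stated over `L : PeriodPair` exactly as the tree's
elliptic facts are (a cubic given by coefficients needs, in addition, the uniformisation theorem
`∃ L, L.g₂ = g₂ ∧ L.g₃ = g₃`, not in the tree); the CM analogue is true but needs CM point-logarithm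
independence (Masser–Wüstholz), not in the tree. -/
def CubicSegments : Prop :=
  ∀ (L : PeriodPair) (a b a' b' : ℚ) (r r' : KZ.IntegralRep 2),
    IsAlgebraic ℚ L.g₂ → IsAlgebraic ℚ L.g₃ → L.g₂.im = 0 → L.g₃.im = 0 → ¬ L.HasCM →
    (∀ x : ℝ, (a : ℝ) ≤ x → x ≤ (b : ℝ) → 0 < 4 * x ^ 3 - L.g₂.re * x - L.g₃.re) →
    (∀ x : ℝ, (a' : ℝ) ≤ x → x ≤ (b' : ℝ) → 0 < 4 * x ^ 3 - L.g₂.re * x - L.g₃.re) →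
    r.domain = {z | (a : ℝ) < z 0 ∧ z 0 < (b : ℝ) ∧ 0 < z 1 ∧
      z 1 < Real.sqrt (4 * z 0 ^ 3 - L.g₂.re * z 0 - L.g₃.re)} →
    r'.domain = {z | (a' : ℝ) < z 0 ∧ z 0 < (b' : ℝ) ∧ 0 < z 1 ∧
      z 1 < Real.sqrt (4 * z 0 ^ 3 - L.g₂.re * z 0 - L.g₃.re)} →
    (∀ z ∈ r.domain, r.integrand z = 1) → (∀ z ∈ r'.domain, r'.integrand z = 1) →
    r.value = r'.value →
    KZ.of r - KZ.of r' ∈ planarGroup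

/-- Rung 1 is a special case of the crux. -/
theorem cubicSegments_of_crux (h : PlanarK0Injective) : CubicSegments :=
  fun _ _ _ _ _ r r' _ _ _ _ _ _ _ _ _ hr hr' hv => h r r' hr hr' hv

/-- **The translation shear (engine of rung 1, one instance typed).** For the Weierstrass cubic
`y² = f(x)` and a point `P = (xP, yP)` on it, the `x`-coordinate of `τ_P(x, y) = (x, y) ⊕ P` along
the upper branch, `X(x) = ((√f(x) − yP)/(x − xP))² − c₂ − x − xP` (chord–tangent law for
`f = x³ + c₂x² + c₁x + c₀`), is piecewise monotone, and on a monotonicity interval `(α, β)`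
avoiding `xP` the FiniteMapShear `(x, v) ↦ (X x, v / |X′ x|)` carries the cell of `dx/y` over
`(α, β)` onto the cell of `dx/|y|` over `X(α, β)` — ONE change-of-variables instance
(`τ_P^*(dx/y) = dx/y`). Stated for an increasing piece landing on the upper branch. -/
def TranslationShear : Prop :=
  ∀ (c₂ c₁ c₀ xP yP α β : ℝ) (r r' : KZ.IntegralRep 2),
    IsAlgebraic ℚ c₂ → IsAlgebraic ℚ c₁ → IsAlgebraic ℚ c₀ → IsAlgebraic ℚ xP → IsAlgebraic ℚ yP →
    yP ^ 2 = xP ^ 3 + c₂ * xP ^ 2 + c₁ * xP + c₀ → α < β → (xP < α ∨ β < xP) →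
    (∀ x ∈ Set.Ioo α β, 0 < x ^ 3 + c₂ * x ^ 2 + c₁ * x + c₀) →
    let f : ℝ → ℝ := fun x => x ^ 3 + c₂ * x ^ 2 + c₁ * x + c₀
    let X : ℝ → ℝ := fun x => ((Real.sqrt (f x) - yP) / (x - xP)) ^ 2 - c₂ - x - xP
    (∀ x ∈ Set.Ioo α β, 0 < deriv X x) →
    (∀ x ∈ Set.Ioo α β, 0 < f (X x)) →
    -- the image arc lies on the UPPER branch: Y(x) = -(yP + λ (X x - xP)) > 0
    (∀ x ∈ Set.Ioo α β, 0 < -(yP + (Real.sqrt (f x) - yP) / (x - xP) * (X x - xP))) →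
    r.domain = {z | z 0 ∈ Set.Ioo α β ∧ 0 < z 1 ∧ z 1 < 1 / Real.sqrt (f (z 0))} →
    r'.domain = {q | q 0 ∈ X '' Set.Ioo α β ∧ 0 < q 1 ∧ q 1 < 1 / Real.sqrt (f (q 0))} →
    (∀ z ∈ r.domain, r.integrand z = 1) → (∀ q ∈ r'.domain, r'.integrand q = 1) →
    KZ.of r - KZ.of r' ∈ KZ.changeOfVariablesRel

/-! ## Card `sheet-cauchy-riemann-transport` -/

/-- **The engine: Cauchy–Riemann transport** (the `n = 2` instance of the support
`EqualJacobianTransport` in which the two maps are `Ψ₁ = (a, U)` and `Ψ₂ = (b, −V)` for a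
Cauchy–Riemann pair `(U, V) = (Re h, Im h)` of `ℚ`-semialgebraic `C¹` functions on an open planar
semialgebraic `W` off the fold locus `{U_b = 0} = {Im h′ = 0}`): `|det DΨ₁| = |U_b| = |V_a| =
|det DΨ₂|`, so the integrand-1 representations on `Ψ₁(W)` (the `a`-sweep of `Re h`) and `Ψ₂(W)`
(the `b`-sweep of `−Im h`) differ by ONE change-of-variables instance. Summed over the fold-free
CAD pieces of a sheet this is Cauchy's theorem `Re ∮ h dz = 0` as planar cut-and-paste; no
potential, no standard triangle. -/
def CauchyRiemannTransport : Prop :=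
  ∀ (W : Set (Fin 2 → ℝ)) (U V : (Fin 2 → ℝ) → ℝ),
    IsOpen W → Literature.ModelTheory.ExponentialFields.IsSemialgebraic ℚ W →
    IsSemialgebraicFunOn ℚ W U → IsSemialgebraicFunOn ℚ W V →
    ContDiffOn ℝ 1 U W → ContDiffOn ℝ 1 V W →
    (∀ p ∈ W, fderiv ℝ U p (Pi.single 0 1) = fderiv ℝ V p (Pi.single 1 1)) →
    (∀ p ∈ W, fderiv ℝ U p (Pi.single 1 1) = -fderiv ℝ V p (Pi.single 0 1)) →
    (∀ p ∈ W, fderiv ℝ U p (Pi.single 1 1) ≠ 0) →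
    Set.InjOn (fun p : Fin 2 → ℝ => (![p 0, U p] : Fin 2 → ℝ)) W →
    Set.InjOn (fun p : Fin 2 → ℝ => (![p 1, -V p] : Fin 2 → ℝ)) W →
    ∀ (r r' : KZ.IntegralRep 2),
      r.domain = (fun p : Fin 2 → ℝ => (![p 0, U p] : Fin 2 → ℝ)) '' W →
      r'.domain = (fun p : Fin 2 → ℝ => (![p 1, -V p] : Fin 2 → ℝ)) '' W →
      (∀ q ∈ r.domain, r.integrand q = 1) → (∀ q ∈ r'.domain, r'.integrand q = 1) →
      KZ.of r - KZ.of r' ∈ KZ.changeOfVariablesRel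

/-- **Genus-2 calibration (first lemma of the line): the dividing-quintic relation.** For
`f ∈ ℚ[x]` of degree 5 with positive leading coefficient and five real roots `e₀ < ⋯ < e₄`, the
three positive real cells of `dx/y` on `y² = f(x)` — over `(e₀,e₁)`, `(e₂,e₃)`, `(e₄,∞)` — satisfy
`[r₁] − [r₂] + [r₃] ∈ G` (areas: `I₁ − I₂ + I₃ = 0`, Cauchy's theorem for the branch of `1/√f`
on the upper half-plane: the alternating sum of real ovals bounds half of `C(ℂ)`). On the planar
side this is the first relation that no automorphism/translation shear can produce (generic
genus 2: `Aut = ⟨ι⟩`, no group law on `C`), realised by Cauchy–Riemann transports on the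
fold-free CAD pieces of the upper half-sheet. Numerics (folder): `f = (x+2)(x+1)(x−½)(x−1)(x−3)`,
`I₁ − I₂ + I₃ = −3.9e−12`; same for `x dx/y`: `−2.6e−11`. -/
def QuinticCauchyRelation : Prop :=
  ∀ (f : Polynomial ℚ) (e : Fin 5 → ℝ) (r₁ r₂ r₃ : KZ.IntegralRep 2),
    f.natDegree = 5 → 0 < f.leadingCoeff → StrictMono e →
    (∀ i, (f.map (algebraMap ℚ ℝ)).eval (e i) = 0) →
    r₁.domain = {z | e 0 < z 0 ∧ z 0 < e 1 ∧ 0 < z 1 ∧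
      z 1 < 1 / Real.sqrt ((f.map (algebraMap ℚ ℝ)).eval (z 0))} →
    r₂.domain = {z | e 2 < z 0 ∧ z 0 < e 3 ∧ 0 < z 1 ∧
      z 1 < 1 / Real.sqrt ((f.map (algebraMap ℚ ℝ)).eval (z 0))} →
    r₃.domain = {z | e 4 < z 0 ∧ 0 < z 1 ∧
      z 1 < 1 / Real.sqrt ((f.map (algebraMap ℚ ℝ)).eval (z 0))} →
    (∀ z ∈ r₁.domain, r₁.integrand z = 1) → (∀ z ∈ r₂.domain, r₂.integrand z = 1) →
    (∀ z ∈ r₃.domain, r₃.integrand z = 1) →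
    KZ.of r₁ - KZ.of r₂ + KZ.of r₃ ∈ planarGroup

end

end Summit.KontsevichZagierPeriods.KontsevichZagierPeriods.Cruxes.PlanarK0Injective.Ideator3
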